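import Literature.MathematicalPhysics.QuantumFieldTheory.Balaban1983to89.B8Thm4MultiLevelTorus
import Literature.MathematicalPhysics.QuantumFieldTheory.Balaban1983to89.B8Prop3MultiLevelTorusP26L3
import Literature.MathematicalPhysics.QuantumFieldTheory.Balaban1983to89.B8Ineq192MultiLevelTorusL0

/-!
# `Balaban1983to89.B8Thm4MultiLevelTorusL3` — THE `L ≥ 3`, `Λ₀`-ADMITTING TWIN of `B8Thm4MultiLevelTorus.thm4_multiLevelTorus_V1` /
# `thm2_multiLevelTorus_V1` (T. Bałaban, *Spaces of regular gauge field configurations on a lattice and gauge fixing conditions*,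
# Commun. Math. Phys. **99** (1985) 75–102 [Balaban1985RegularSpaces], **THEOREM 4** p. 88 and through it **THEOREM 2** p. 83, AT THE
# FLAT BACKGROUND `U₀ = 1`, linear chart, on print's `k`-LEVEL V1 TORUS `Λ₀ ⊂ T_η = Ω₀ ⊃ Ω₁ ⊃ … ⊃ Ω_k`) — NOW FOR EVERY ODD `L ≥ 3`
# AND ON THE LEVEL-0-ADMITTING CARRIERS (`B6MultiLevelTorusOperatorL0.TDomains`, `B6GlobalChartV1L0.domT` / `blkV1`)

statement-level skeleton of published theorems with citation tags; proofs where landed; nothing here is a claim about the Yang–Mills mass gap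

WHY THIS FILE.  r05's `B8Thm4MultiLevelTorus` (gen 71) reads Theorem 4 / Theorem 2 at `U₀ = 1` on the `k`-level V1 torus through the
endpoint `B8Prop3MultiLevelTorusP26.prop3_multiLevelTorus_V1_P26_vector` (carriers `B6MultiLevelTorusOperator.TDomains`, `Ω₁ = T_η`) and
carries ONE floor binder `(_ : 4 ≤ ℓ)` (block size `L = ℓ + 1 ≥ 5`), used ONCE: it is handed to that endpoint.  The `Λ₀`-admitting
endpoint `B8Prop3MultiLevelTorusP26L0.prop3_multiLevelTorus_V1_P26_vector` (carriers `…OperatorL0.TDomains`, print's region `Λ₀ = T ∖ Ω₁`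
admitted) has the floor-free twin ✓ `B8Prop3MultiLevelTorusP26L3.prop3_multiLevelTorus_V1_P26_vector_L3` (cell `pub∕ym-inputs` seat p06 g2,
2026-08-28; producer = the lit-balaban V1L3 lineage's `B6Prop26GradKLevelV1L3.prop26_2136_grad_kLevel_unconditional_pad_V1`, every odd
`L ≥ 3`).  The two remaining ingredients of r05's §2 proof are carrier-generic: p21's `B6SectACriticalPointV1.existsUnique_gauge212` and
r05's own `B8Thm4MultiLevelTorus.data_of_restricted` are stated for ANY `D : B6SectADomainsV1.Domains P`, and `B6GlobalChartV1L0.domT hN D hk`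
IS such a `Domains (PV …)`.  So r05's §2/§3 proofs go through VERBATIM on the L0 carriers with the `_L3` endpoint and WITHOUT the floor:
★ `thm4_multiLevelTorus_V1_L3`, ★ `thm2_multiLevelTorus_V1_L3` — binders = r05's minus `(_ : 4 ≤ ℓ)` (read on the L0 carriers), conclusions
VERBATIM.  CONSUMER (rung-R3 cell `ym3-torus`, line H `stub_halvingStep`, LEAD-H ★w5-19200 g4 RULING L-2 (3)): the `cubeSeqMT3` /
`IsLevWeight` port `Theorems/UnitScaleTiltHalvingP1FlatCoreLinearLandau.lean` (★w2-19936 g5) — `cubeSeqMT3 F n K x ρ S M` IS a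
`B6GlobalChartV1L0.domT hN D hk` of a member `D : B6MultiLevelTorusOperatorL0.TDomains 2 ℓ Mh (K−n) P′ R` (the carriers of the H line's
`Theorems/UnitScaleTiltProp8FlatPortKernelRowsL0` / `…AllL` chain), so the port wants Theorem 4♭ on THESE carriers, floor-free — which is
this file (the non-L0 statement would not meet `cubeSeqMT3`'s `domT` literally).

WHAT THIS MODULE PROVES (kernel-checked, 0 sorry, no `… : Prop` fact, TWO theorems).
§1 **`thm4_multiLevelTorus_V1_L3`** — r05's §2 sentence (∃! restricted `λ ∈ N(Q′)` in the Landau gauge (1.38); for every such `λ`,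
   `A := A′ − ∂λ` has (1.37) `QA = QA′`, `∂*∂A = ∂*∂A′`, and with `B₁ = 5dL·B₀′` the (1.36)/(1.39)/(1.62) members `|A|₍₋₁₎, |∇A|₍₋₂₎,
   |ΔA|₍₋₃₎ ≤ B₁(α₀ + α₁)`, `|(∂*∂A)(b)| ≤ B₁(α₀ + α₁)(L^{j(b)}η)⁻³` + the three pointwise «on Ω_j» forms) for EVERY ODD `L ≥ 3`, `k ≥ 1`,
   `P′ ≥ 5L`, `M_h = Lᵃ ≥ 8`, `R ≥ 2L²`, ONE size threshold `M₄ ≤ L·M_h`, on every `Λ₀`-admitting nested family `D`.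
§2 **`thm2_multiLevelTorus_V1_L3`** — the same packaged as Theorem 2's sentence, as r05's §3.

HONEST SCOPE / NOT CLAIMED.  Pure plumbing: r05's two proofs with ONE `obtain` re-pointed (`…_P26_vector ↦ …_P26_vector_L3`) and the floor
binder deleted; no module of the r05 / L0 / V1L3 lineages is touched; no fact is minted; nothing of print is asserted beyond what r05's file
and the `_L3` endpoint prove (in particular: `U₀ = 1` and the LINEAR chart ONLY; the Hölder member of (1.36) is NOT part of the instance; «≦»
for print's «<»; constants existential in `d, L, σ, α, b₀, b₁`; real scalar fibre — see r05's HONEST SCOPE (i)–(vi), which applies word for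
word).  The range «every odd `L ≥ 3`» is a statement about the TREE's typed producer chain (the V1L3 lineage), not a page citation (print puts
no floor on `L`).  Rows B8.Thm4 / B8.Thm2 heads do NOT move.  One finite-lattice statement at fixed `η`; nothing continuum / ℝ⁴ / OS / mass-gap / Clay.
No `sorry`, no `def`, no `instance`, no `notation`.  Cell `pub∕ym-inputs` seat `ym-inputs-p07` g3 (ym3-torus L-FLOOR LEDGER, H-line B3
component), 2026-08-28.

PDF held: `paper:balaban1985-cmp99-regular-spaces-gauge-fixing` (journal page = PDF page + 74): Thm 4 p. 88, Thm 2 p. 83, (1.29) p. 81,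
(1.36)–(1.38) p. 82, (1.39) p. 83, (1.55) p. 86, Prop. 3 + (1.62) p. 87 — quotations in r05's parent module docstring (verbatim there).
[B6] = [Balaban1984PropagatorsII] (2.7) p. 224, (2.12) p. 225 (through p21's `B6SectACriticalPointV1`).

USED BY NAME, nothing re-declared: `B8Thm4MultiLevelTorus.data_of_restricted` (r05), `B8Prop3MultiLevelTorusP26L3.prop3_multiLevelTorus_V1_P26_vector_L3`
(p06 g2), `B6SectACriticalPointV1.existsUnique_gauge212` (p21), `B6GlobalChartV1.PV`, `B6GlobalChartV1L0.{domT, blkV1}`,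
`B6MultiLevelTorusOperatorL0.TDomains`, `B6Geom246MultiLevelTorusL0.geomT`, `B8Ineq192MultiLevelTorusL0.lenT_pos`, `B6CubeWindowV1.GlobalBand`,
`B6GradLegKLevelV1.DV`, `B8ScaledSupNorm.msup`, `LatticeFieldCalculus.laplace`, `B6SectAOperatorsV1.{dE, dsE, dcE, dcsE, QE, QpE, RE, ScalarSpace, BondIdx}`.
-/

open scoped BigOperators

namespace Literature.MathematicalPhysics.QuantumFieldTheory.Balaban1983to89.B8Thm4MultiLevelTorusL3

open B6MultiLevelBoxOperator (N0)
open B6MultiLevelTorusOperatorL0 (TDomains)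
open B6Geom246MultiLevelTorusL0 (geomT)
open B6GlobalChartV1 (PV)
open B6GlobalChartV1L0 (domT blkV1)
open B8Ineq192MultiLevelTorusL0 (lenT_pos)
open B6SectAOperatorsV1 (dE dsE dcE dcsE QE QpE RE ScalarSpace BondIdx)
open B6SectACriticalPointV1 (existsUnique_gauge212)
open B6CubeWindowV1 (GlobalBand)
open B6GradLegKLevelV1 (DV)
open BalabanImbrieJaffe1984to88.BIJ85AxialPropagator411 (BondSpace)
open B8ScaledSupNorm (msup)
open LatticeFieldCalculus (laplace)
open B8Prop3MultiLevelTorusP26L3 (prop3_multiLevelTorus_V1_P26_vector_L3)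
open B8Thm4MultiLevelTorus (data_of_restricted)

noncomputable section

/-! ## §1 Theorem 4 at `U₀ = 1` on the `k`-level V1 torus, `Λ₀` admitted, every odd `L ≥ 3` -/

open Classical in
/-- ★ **THEOREM 4 AT THE FLAT BACKGROUND `U₀ = 1` ON THE `k`-LEVEL V1 TORUS, `Λ₀` ADMITTED, EVERY ODD `L ≥ 3`** — the twin of r05's
`B8Thm4MultiLevelTorus.thm4_multiLevelTorus_V1` on the level-0-admitting carriers (`B6MultiLevelTorusOperatorL0.TDomains`, `B6GlobalChartV1L0.domT`
/ `blkV1`) with the floor binder `(_ : 4 ≤ ℓ)` DELETED (binders otherwise verbatim, conclusions verbatim) (p. 88, verbatim: *"There exists a constant c₁ such that for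
arbitrary U₀, U′U₀ satisfying (1.33), (1.34), (1.66) with α₀ + α₁ ≦ c₁ there exists exactly one gauge transformation u satisfying (1.29)
and such that the conditions (1.37), (1.38), (1.62) hold for the configuration U₁ = U′^{u⁻¹}"*) — typed reading in the linear chart (see
THE INSTANCE in the parent module): for the weight band `0 < b₀ ≤ b₁` there is `σ₀ > 0` such that for all `σ ∈ (0, σ₀]`, `α ∈ (0, 1)` there are ONE constant
`B₀′ ≥ 1` and ONE threshold `M₄ > 0` such that on every admissible `k`-level V1 torus (every odd `L ≥ 3`, `k ≥ 1`, `P′ ≥ 5L`), for every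
`α₀, α₁ ≥ 0` and every perturbation `A′` with the processed (1.34)/(1.66) sizes `|(∂*∂A′)(b)| ≤ 2α₀(L^{j(b)}η)⁻³`, `|(Q_jA′)(c)| ≤
2dLα₁(Lʲη)⁻¹` on `Λ_j`: (i) «exactly one gauge transformation u satisfying (1.29) and … (1.38)» — `∃! λ ∈ N(Q′)`, `R∂*(A′ − ∂λ) = 0`
(p21's `existsUnique_gauge212`); (ii) for every such `λ`, `A := A′ − ∂λ` satisfies (1.37) `QA = QA′`, `∂*∂A = ∂*∂A′`, and with
`B₁ = 5dL·B₀′` («B₁ = 5dLB₀», Prop. 3) the members of (1.36)/(1.39)/(1.62): `|A|₍₋₁₎ ≤ B₁(α₀ + α₁)`, `|∇A|₍₋₂₎ ≤ B₁(α₀ + α₁)`,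
`|(∂*∂A)(b)| ≤ B₁(α₀ + α₁)(L^{j(b)}η)⁻³`, `|ΔA|₍₋₃₎ ≤ B₁(α₀ + α₁)` and the three pointwise «on Ω_j» forms — the floor-free
`B8Prop3MultiLevelTorusP26L3.prop3_multiLevelTorus_V1_P26_vector_L3` with its B8-side hypotheses (1.55)/(1.42)/(1.56) DISCHARGED (`J := ∂*∂A′`, the Landau clause of `λ`,
`B := QA′`; `α₂ = C₂ = 0`).  No threshold `c₁`, no [B6]-side hypothesis. [cite: Balaban1985RegularSpaces, Thm 4 p.88, (1.67) p.88, Thm 2 p.83, (1.29) p.81, (1.36)–(1.38) p.82, (1.39) p.83, (1.62) + Prop. 3 p.87, (1.55)–(1.56) p.86, (1.66) p.87; Balaban1984PropagatorsII, (2.7) p.224, (2.12) p.225] -/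
theorem thm4_multiLevelTorus_V1_L3 (d ℓ : ℕ) (hd : 1 ≤ d + 1) (hL : Odd (ℓ + 1) ∧ 1 < ℓ + 1) {b₀ b₁ : ℝ} (hb₀ : 0 < b₀) (hb₁ : b₀ ≤ b₁) :
    ∃ σ₀ : ℝ, 0 < σ₀ ∧ ∀ (σ : ℝ), 0 < σ → σ ≤ σ₀ → ∀ (α : ℝ), 0 < α → α < 1 →
    ∃ B₀' M₄ : ℝ, 1 ≤ B₀' ∧ 0 < M₄ ∧
    ∀ (m K : ℕ) {Mh k R : ℕ} {P' : Fin (d + 1) → ℕ}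
      (hN : ∀ μ, N0 ℓ Mh k P' μ = (PV d ℓ m K hd hL).sitesPerDir 0) (D : TDomains d ℓ Mh k P' R) (hk : k ≤ m + K) (_ : 1 ≤ k)
      {a : ℕ} (_ : Mh = (ℓ + 1) ^ a) (_ : 8 ≤ Mh) (_ : 2 * (ℓ + 1) ^ 2 ≤ R) (_ : ∀ μ, 5 * (ℓ + 1) ≤ P' μ)
      (_ : M₄ ≤ ((ℓ : ℝ) + 1) * Mh)
      {cf : ℝ} (_ : cf ≠ 0) {w : BondIdx (domT hN D hk) → ℝ} (_ : ∀ i, 0 < w i) (_ : GlobalBand b₀ b₁ cf w),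
      ∀ (A' : BondSpace (PV d ℓ m K hd hL)) (α₀ α₁ : ℝ), 0 ≤ α₀ → 0 ≤ α₁ →
        -- (1.34) processed through (1.55) at `U₀ = 1`: `|D*DA′|₍₋₃₎ ≦ 2α₀` (the α₂-terms of (1.55) are absent in the linear chart)
        (∀ b, |dcsE cf (dcE cf A') b| ≤ 2 * α₀ * (((geomT D).len (blkV1 hN D b) * |cf|⁻¹) ^ 3)⁻¹) →
        -- (1.66)/(1.35) processed through (1.37)/(1.56): `|Q_jA′| ≦ 2dLα₁(Lʲη)⁻¹` on `Λ_j`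
        (∀ i, |QE (domT hN D hk) A' i| ≤ 2 * ((d : ℝ) + 1) * ((ℓ : ℝ) + 1) * α₁ * (((ℓ : ℝ) + 1) ^ (i.1.1 : ℕ) * |cf|⁻¹)⁻¹) →
        -- «there exists exactly one gauge transformation u satisfying (1.29) and such that … (1.38)»
        (∃! n : ScalarSpace (PV d ℓ m K hd hL),
            n ∈ LinearMap.ker (QpE (domT hN D hk)) ∧ RE (domT hN D hk) cf (dsE cf (A' - dE cf n)) = 0) ∧
        -- and for it — indeed for every restricted `λ` in the Landau gauge — `A := A′ − ∂λ` satisfies (1.37), (1.36)/(1.39)/(1.62):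
        ∀ n : ScalarSpace (PV d ℓ m K hd hL), n ∈ LinearMap.ker (QpE (domT hN D hk)) →
          RE (domT hN D hk) cf (dsE cf (A' - dE cf n)) = 0 →
          -- (1.37) «basically of an algebraic character»: `QA = QA′`
          QE (domT hN D hk) (A' - dE cf n) = QE (domT hN D hk) A' ∧
          -- (1.55)'s `J = D*DA = D*DA′`
          dcsE cf (dcE cf (A' - dE cf n)) = dcsE cf (dcE cf A') ∧
          -- (1.36)/(1.62): `|A|₍₋₁₎ ≦ 5dLB₀(α₀ + α₁)`
          msup (ℓ + 1) k |cf|⁻¹ (-1) (fun j (b : PBond (PV d ℓ m K hd hL) 0) => j ≤ (blkV1 hN D b).1.1) (WithLp.ofLp (A' - dE cf n)) ≤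
              5 * ((d : ℝ) + 1) * ((ℓ : ℝ) + 1) * B₀' * (α₀ + α₁) ∧
          -- (1.36)/(1.62): `|∇^η_{U₀}A|₍₋₂₎ ≦ 5dLB₀(α₀ + α₁)` (componentwise forward differences at `U₀ = 1`)
          msup (ℓ + 1) k |cf|⁻¹ (-2) (fun j (p : Fin (d + 1) × PBond (PV d ℓ m K hd hL) 0) => j ≤ (blkV1 hN D p.2).1.1)
              (fun p : Fin (d + 1) × PBond (PV d ℓ m K hd hL) 0 => DV (P := PV d ℓ m K hd hL) p.1 cf (WithLp.ofLp (A' - dE cf n)) p.2) ≤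
              5 * ((d : ℝ) + 1) * ((ℓ : ℝ) + 1) * B₀' * (α₀ + α₁) ∧
          -- (1.39)/(1.62): `|D^{η*}_{U₀}D^η_{U₀}A| ≦ 5dLB₀(α₀ + α₁)(Lʲη)⁻³ on Ω_j`
          (∀ b : PBond (PV d ℓ m K hd hL) 0,
              |dcsE cf (dcE cf (A' - dE cf n)) b| ≤ 5 * ((d : ℝ) + 1) * ((ℓ : ℝ) + 1) * B₀' * (α₀ + α₁) *
                (((geomT D).len (blkV1 hN D b) * |cf|⁻¹) ^ 3)⁻¹) ∧
          -- (1.39)/(1.62): `|Δ^η_{U₀}A|₍₋₃₎ ≦ 5dLB₀(α₀ + α₁)` (componentwise `Δ` at `U₀ = 1`)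
          msup (ℓ + 1) k |cf|⁻¹ (-3) (fun j (b : PBond (PV d ℓ m K hd hL) 0) => j ≤ (blkV1 hN D b).1.1)
              (fun b : PBond (PV d ℓ m K hd hL) 0 => laplace cf (fun z => (A' - dE cf n) ⟨z, b.dir⟩) b.src) ≤
              5 * ((d : ℝ) + 1) * ((ℓ : ℝ) + 1) * B₀' * (α₀ + α₁) ∧
          -- the three pointwise «on Ω_j» forms of (1.36)/(1.39)
          (∀ b : PBond (PV d ℓ m K hd hL) 0,
              |WithLp.ofLp (A' - dE cf n) b| ≤ 5 * ((d : ℝ) + 1) * ((ℓ : ℝ) + 1) * B₀' * (α₀ + α₁) *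
                (((geomT D).len (blkV1 hN D b) * |cf|⁻¹) ^ 1)⁻¹) ∧
          (∀ (ν : Fin (d + 1)) (b : PBond (PV d ℓ m K hd hL) 0),
              |DV (P := PV d ℓ m K hd hL) ν cf (WithLp.ofLp (A' - dE cf n)) b| ≤ 5 * ((d : ℝ) + 1) * ((ℓ : ℝ) + 1) * B₀' * (α₀ + α₁) *
                (((geomT D).len (blkV1 hN D b) * |cf|⁻¹) ^ 2)⁻¹) ∧
          (∀ b : PBond (PV d ℓ m K hd hL) 0,
              |laplace cf (fun z => (A' - dE cf n) ⟨z, b.dir⟩) b.src| ≤ 5 * ((d : ℝ) + 1) * ((ℓ : ℝ) + 1) * B₀' * (α₀ + α₁) *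
                (((geomT D).len (blkV1 hN D b) * |cf|⁻¹) ^ 3)⁻¹) := by
  -- Proposition 3 at `U₀ = 1` on the `k`-level V1 torus, `Λ₀` admitted, every odd `L ≥ 3`, no [B6]-side hypothesis (`_vector_L3`)
  obtain ⟨σ₀, hσ₀, h3⟩ := prop3_multiLevelTorus_V1_P26_vector_L3 d ℓ hd hL hb₀ hb₁
  refine ⟨σ₀, hσ₀, fun σ hσ hσle α hα0 hα1 => ?_⟩
  obtain ⟨B₀, KL, hB₀, hKL, Amaj, M₄, hA, hM₄, hP3⟩ := h3 σ hσ hσle α hα0 hα1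
  -- Prop. 3's constant «B₀» at `U₀ = 1`: `B₀′ = K_L(B₀A + 1)(1 + 2b₁) ≥ 1`
  have hb₁0 : 0 ≤ b₁ := hb₀.le.trans hb₁
  have hB₀' : (1 : ℝ) ≤ KL * ((B₀ * Amaj + 1) * (1 + 2 * b₁)) := by
    have h1 : (1 : ℝ) ≤ B₀ * Amaj + 1 := le_add_of_nonneg_left (mul_nonneg (zero_le_one.trans hB₀) hA)
    have h2 : (1 : ℝ) ≤ 1 + 2 * b₁ := le_add_of_nonneg_right (by positivity)
    exact one_le_mul_of_one_le_of_one_le hKL (one_le_mul_of_one_le_of_one_le h1 h2)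
  refine ⟨KL * ((B₀ * Amaj + 1) * (1 + 2 * b₁)), M₄, hB₀', hM₄, ?_⟩
  intro m K Mh k R P' hN D hk hk1 a hMha hM8 hR2 hP hM4t cf hcf w hw hwb A' α₀ α₁ hα₀ hα₁ hJ hB
  refine ⟨existsUnique_gauge212 (domT hN D hk) hcf A', fun n hn hLan => ?_⟩
  -- the construction's data: (1.37) `QA = QA′` and `J = ∂*∂A = ∂*∂A′`
  obtain ⟨h37, h55⟩ := data_of_restricted (domT hN D hk) cf A' hn
  -- print's `d`, `L` as reals: `0 ≤ d`, `1 ≤ dL`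
  have hdP : (0 : ℝ) ≤ (d : ℝ) + 1 := by positivity
  have hdL : (1 : ℝ) ≤ ((d : ℝ) + 1) * ((ℓ : ℝ) + 1) :=
    one_le_mul_of_one_le_of_one_le (le_add_of_nonneg_left (Nat.cast_nonneg d)) (le_add_of_nonneg_left (Nat.cast_nonneg ℓ))
  -- Proposition 3 fed with `J := ∂*∂A′`, the Landau clause, `B := QA′`, `n_J = 2α₀`, `n_B = 2dLα₁`, `α₂ = C₂ = 0`
  have h := hP3 m K hN D hk hk1 hMha hM8 hR2 hP hM4t hcf hw hwb (A' - dE cf n) (dcsE cf (dcE cf A'))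
    (QE (domT hN D hk) A') h55 hLan h37 (2 * α₀) (2 * ((d : ℝ) + 1) * ((ℓ : ℝ) + 1) * α₁) (by positivity) (by positivity) hJ hB
    ((d : ℝ) + 1) ((ℓ : ℝ) + 1) 0 α₀ α₁ 0 hdP hdL hα₀ hα₁ le_rfl (le_of_eq (by ring)) (le_of_eq (by ring)) (by norm_num) (by norm_num)
    (by norm_num; exact add_nonneg hα₀ hα₁)
  obtain ⟨hA1, hA2, hJ3, hA4, hp1, hp2, hp3⟩ := h
  refine ⟨h37, h55, hA1, hA2, fun b => ?_, hA4, hp1, hp2, hp3⟩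
  -- (1.39)/(1.62) for `D*DA = J`: `|J(b)| ≤ 2α₀·w₃(b) ≤ B₁(α₀ + α₁)·w₃(b)`
  have hw3 : (0 : ℝ) ≤ (((geomT D).len (blkV1 hN D b) * |cf|⁻¹) ^ 3)⁻¹ :=
    inv_nonneg.2 (pow_nonneg (mul_nonneg (lenT_pos D _).le (inv_nonneg.2 (abs_nonneg cf))) 3)
  rw [h55]
  exact (hJ b).trans (mul_le_mul_of_nonneg_right hJ3 hw3)

/-! ## §2 Theorem 2 at `U₀ = 1` on the `k`-level V1 torus, `Λ₀` admitted, every odd `L ≥ 3` -/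

open Classical in
/-- ★ **THEOREM 2 AT THE FLAT BACKGROUND `U₀ = 1` ON THE `k`-LEVEL V1 TORUS, `Λ₀` ADMITTED, EVERY ODD `L ≥ 3`** (the twin of r05's
`B8Thm4MultiLevelTorus.thm2_multiLevelTorus_V1`, floor binder deleted, L0 carriers; «Of course this theorem implies Theorem 2», p. 88): with
the constant `B₁ = 5dL·B₀′` of `thm4_multiLevelTorus_V1_L3` — *"There exist constants B₁, … such that for arbitrary U₀, U′U₀ satisfying
(1.33)–(1.35) … there exists exactly one gauge transformation u satisfying (1.29) and such that the conditions (1.36)–(1.39) hold for the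
configuration U₁ = U′^{u⁻¹}"* — read in the linear chart on the multi-level torus: ∃! restricted `λ ∈ N(Q′)` in the Landau gauge
(1.38), and for it (1.36) `|A|₍₋₁₎, |∇^η_{U₀}A|₍₋₂₎ ≦ B₁(α₀ + α₁)`, (1.37) `Q_jA = Q_jA′` («|B| < 2dLα₁ by the assumption (1.35)»),
(1.39) `|D^{η*}_{U₀}D^η_{U₀}A| ≦ B₁(α₀ + α₁)(Lʲη)⁻³ on Ω_j`, `|Δ^η_{U₀}A|₍₋₃₎ ≦ B₁(α₀ + α₁)`.  The Hölder member of (1.36) is not part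
of the instance (parent module's HONEST SCOPE (ii)). [cite: Balaban1985RegularSpaces, Thm 2 p.83, (1.36)–(1.38) p.82, (1.39) p.83, (1.29) p.81, Thm 4 p.88; Balaban1984PropagatorsII, (2.7) p.224, (2.12) p.225] -/
theorem thm2_multiLevelTorus_V1_L3 (d ℓ : ℕ) (hd : 1 ≤ d + 1) (hL : Odd (ℓ + 1) ∧ 1 < ℓ + 1) {b₀ b₁ : ℝ} (hb₀ : 0 < b₀) (hb₁ : b₀ ≤ b₁) :
    ∃ σ₀ : ℝ, 0 < σ₀ ∧ ∀ (σ : ℝ), 0 < σ → σ ≤ σ₀ → ∀ (α : ℝ), 0 < α → α < 1 →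
    ∃ B₁ M₄ : ℝ, 1 ≤ B₁ ∧ 0 < M₄ ∧
    ∀ (m K : ℕ) {Mh k R : ℕ} {P' : Fin (d + 1) → ℕ}
      (hN : ∀ μ, N0 ℓ Mh k P' μ = (PV d ℓ m K hd hL).sitesPerDir 0) (D : TDomains d ℓ Mh k P' R) (hk : k ≤ m + K) (_ : 1 ≤ k)
      {a : ℕ} (_ : Mh = (ℓ + 1) ^ a) (_ : 8 ≤ Mh) (_ : 2 * (ℓ + 1) ^ 2 ≤ R) (_ : ∀ μ, 5 * (ℓ + 1) ≤ P' μ)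
      (_ : M₄ ≤ ((ℓ : ℝ) + 1) * Mh)
      {cf : ℝ} (_ : cf ≠ 0) {w : BondIdx (domT hN D hk) → ℝ} (_ : ∀ i, 0 < w i) (_ : GlobalBand b₀ b₁ cf w),
      ∀ (A' : BondSpace (PV d ℓ m K hd hL)) (α₀ α₁ : ℝ), 0 ≤ α₀ → 0 ≤ α₁ →
        (∀ b, |dcsE cf (dcE cf A') b| ≤ 2 * α₀ * (((geomT D).len (blkV1 hN D b) * |cf|⁻¹) ^ 3)⁻¹) →
        (∀ i, |QE (domT hN D hk) A' i| ≤ 2 * ((d : ℝ) + 1) * ((ℓ : ℝ) + 1) * α₁ * (((ℓ : ℝ) + 1) ^ (i.1.1 : ℕ) * |cf|⁻¹)⁻¹) →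
        ∃! n : ScalarSpace (PV d ℓ m K hd hL),
          -- (1.29) restricted, (1.38) Landau gauge
          n ∈ LinearMap.ker (QpE (domT hN D hk)) ∧ RE (domT hN D hk) cf (dsE cf (A' - dE cf n)) = 0 ∧
          -- (1.37)
          QE (domT hN D hk) (A' - dE cf n) = QE (domT hN D hk) A' ∧
          -- (1.36) sup members
          msup (ℓ + 1) k |cf|⁻¹ (-1) (fun j (b : PBond (PV d ℓ m K hd hL) 0) => j ≤ (blkV1 hN D b).1.1) (WithLp.ofLp (A' - dE cf n)) ≤
              B₁ * (α₀ + α₁) ∧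
          msup (ℓ + 1) k |cf|⁻¹ (-2) (fun j (p : Fin (d + 1) × PBond (PV d ℓ m K hd hL) 0) => j ≤ (blkV1 hN D p.2).1.1)
              (fun p : Fin (d + 1) × PBond (PV d ℓ m K hd hL) 0 => DV (P := PV d ℓ m K hd hL) p.1 cf (WithLp.ofLp (A' - dE cf n)) p.2) ≤
              B₁ * (α₀ + α₁) ∧
          -- (1.39)
          (∀ b : PBond (PV d ℓ m K hd hL) 0,
              |dcsE cf (dcE cf (A' - dE cf n)) b| ≤ B₁ * (α₀ + α₁) * (((geomT D).len (blkV1 hN D b) * |cf|⁻¹) ^ 3)⁻¹) ∧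
          msup (ℓ + 1) k |cf|⁻¹ (-3) (fun j (b : PBond (PV d ℓ m K hd hL) 0) => j ≤ (blkV1 hN D b).1.1)
              (fun b : PBond (PV d ℓ m K hd hL) 0 => laplace cf (fun z => (A' - dE cf n) ⟨z, b.dir⟩) b.src) ≤ B₁ * (α₀ + α₁) := by
  obtain ⟨σ₀, hσ₀, h4⟩ := thm4_multiLevelTorus_V1_L3 d ℓ hd hL hb₀ hb₁
  refine ⟨σ₀, hσ₀, fun σ hσ hσle α hα0 hα1 => ?_⟩
  obtain ⟨B₀', M₄, hB₀', hM₄, h⟩ := h4 σ hσ hσle α hα0 hα1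
  have hdL : (1 : ℝ) ≤ ((d : ℝ) + 1) * ((ℓ : ℝ) + 1) :=
    one_le_mul_of_one_le_of_one_le (le_add_of_nonneg_left (Nat.cast_nonneg d)) (le_add_of_nonneg_left (Nat.cast_nonneg ℓ))
  refine ⟨5 * ((d : ℝ) + 1) * ((ℓ : ℝ) + 1) * B₀', M₄, ?_, hM₄, ?_⟩
  · -- `1 ≤ 5dL·B₀′`
    calc (1 : ℝ) ≤ 5 * (((d : ℝ) + 1) * ((ℓ : ℝ) + 1)) * 1 := by linarith
      _ ≤ 5 * (((d : ℝ) + 1) * ((ℓ : ℝ) + 1)) * B₀' := mul_le_mul_of_nonneg_left hB₀' (by positivity)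
      _ = 5 * ((d : ℝ) + 1) * ((ℓ : ℝ) + 1) * B₀' := by ring
  intro m K Mh k R P' hN D hk hk1 a hMha hM8 hR2 hP hM4t cf hcf w hw hwb A' α₀ α₁ hα₀ hα₁ hJ hB
  obtain ⟨⟨n, ⟨hn, hLan⟩, huniq⟩, hall⟩ :=
    h m K hN D hk hk1 hMha hM8 hR2 hP hM4t hcf hw hwb A' α₀ α₁ hα₀ hα₁ hJ hB
  obtain ⟨h37, _, hA1, hA2, hJ3, hA4, _, _, _⟩ := hall n hn hLan
  exact ⟨n, ⟨hn, hLan, h37, hA1, hA2, hJ3, hA4⟩, fun n' h' => huniq n' ⟨h'.1, h'.2.1⟩⟩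

end

end Literature.MathematicalPhysics.QuantumFieldTheory.Balaban1983to89.B8Thm4MultiLevelTorusL3
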